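import Literature.Geometry.Lorentzian.CarterSliverCorePoly
import Literature.Geometry.Lorentzian.CarterThresholdCorePoly
import Literature.Geometry.Lorentzian.TeukolskyKernelRegimeReduction
import Summits.FinalStateConjecture.FinalStateConjecture.Theorems.PhaseMixingCaptureKappaExplicitWaveDecayFullConeCensus
import HarnessLib

/-!
# The BF-stable large-Λ cone kernel bound in the threshold layer, Λ-polynomial constants
# (stub `stub_coneKernelLargeStableLayerPoly` of the line `olver-dunster-uniform-reduction`)

Crux `PhaseMixingCapture.KappaExplicitWaveDecay` (stmt-FinalStateConjecture-10654), line
`olver-dunster-uniform-reduction`, stub `stub_coneKernelLargeStableLayerPoly` (T2sA, skeleton v9.2): for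
`M > 0`, `θ > 0`, `θ₁ > 0` there are `ξ₁ > 0`, `Λ₀`, `a₁ < M`, `ε₀ > 0`, `C > 0`, `N` such that the
Green-kernel product of the horizon- and infinity-normalised radial Teukolsky (`s = 0`) solutions obeys

  `√(r² + a²)‖R_𝓗(r)‖ · √(r′² + a²)‖R_𝓘(r′)‖ ≤ C·Λ^N·κ^{−N}·‖𝔚(r)‖`,
  `r₊ < r ≤ r′`, `r′ ≥ r₊ + θ(r₊ − r₋)`,

for every sub-extremal `a₁ ≤ |a| < M`, admissible `(ω, m, Λ)` with `m ≠ 0`, `Λ > Λ₀`, in the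
Breitenlohner–Freedman stable sector with margin `(1 + θ₁)(2r₊ω)² ≤ Λ − 2amω`, in the cone
`|ω − mω₊| ≤ ε₀|m|` and in the THRESHOLD LAYER `|ω − mω₊| ≤ 2ξ₁κ`.

Proof: the two `u`-language cores with Λ-polynomial constants — the exact threshold `ω = mω₊`
(`Kerr.thresholdRegime_corePoly`, `Literature/Geometry/Lorentzian/CarterThresholdCorePoly.lean`) and
the sliver `0 < |ω − mω₊| ≤ 2ξ₁κ` (`Kerr.sliverRegime_corePoly`, `…/CarterSliverCorePoly.lean`) — are
glued by `Kerr.Costa2019.kernelBound_of_tortoise_core_regime` with the `(ω, m) ↦ (−ω, −m)`-invariant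
regime `P a ω m Λ := Λ₀ < Λ ∧ (1 + θ₁)(2r₊ω)² ≤ Λ − 2amω ∧ |ω − mω₊| ≤ 2ξ₁κ`, the census being the
landed `stub_fullConeCensus`. The exponents are unified by `κ ≤ 1/(4M)`, `Λ ≥ 1`.
-/

set_option linter.dupNamespace false

noncomputable section

namespace Summit.FinalStateConjecture.FinalStateConjecture.Theorems.KappaExplicitWaveDecay.OlverDunsterUniformReduction

open Literature.Geometry.Lorentzian Literature.Analysis.ODE
open MeasureTheory Filter Set Complex
open scoped Topology ComplexConjugate

/-- Raising the exponent of a Λ-polynomial constant: for `0 < κ ≤ 1/(4M)`, `1 ≤ Λ`, `0 ≤ C`, `0 ≤ W`,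
`CΛ^Nκ^{−N}W ≤ (C/(4M)^K)Λ^{N+K}κ^{−(N+K)}W`. [folklore] -/
theorem polyConst_raise {M κ Λ C W : ℝ} (N K : ℕ) (hM : 0 < M) (hκ : 0 < κ) (hκle : κ ≤ 1 / (4 * M))
    (hΛ : 1 ≤ Λ) (hC : 0 ≤ C) (hW : 0 ≤ W) :
    C * Λ ^ N * κ⁻¹ ^ N * W ≤ C / (4 * M) ^ K * Λ ^ (N + K) * κ⁻¹ ^ (N + K) * W := by
  have h4M : 0 < 4 * M := by positivity
  have hΛN : Λ ^ N ≤ Λ ^ (N + K) := pow_le_pow_right₀ hΛ (Nat.le_add_right N K)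
  -- `κ⁻¹^N ≤ κ⁻¹^(N+K) / (4M)^K` since `1 ≤ κ⁻¹/(4M)`
  have hone : 1 ≤ κ⁻¹ / (4 * M) := by
    rw [le_div_iff₀ h4M, one_mul]
    calc 4 * M = (1 / (4 * M))⁻¹ := by rw [one_div, inv_inv]
      _ ≤ κ⁻¹ := by rw [inv_le_inv₀ (by positivity) hκ]; exact hκle
  have hκN : κ⁻¹ ^ N ≤ κ⁻¹ ^ (N + K) / (4 * M) ^ K := by
    have h1 : (1:ℝ) ≤ (κ⁻¹ / (4 * M)) ^ K := one_le_pow₀ hone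
    have h0 : 0 ≤ κ⁻¹ ^ N := by positivity
    calc κ⁻¹ ^ N = κ⁻¹ ^ N * 1 := (mul_one _).symm
      _ ≤ κ⁻¹ ^ N * (κ⁻¹ / (4 * M)) ^ K := mul_le_mul_of_nonneg_left h1 h0
      _ = κ⁻¹ ^ (N + K) / (4 * M) ^ K := by rw [div_pow, pow_add]; ring
  calc C * Λ ^ N * κ⁻¹ ^ N * W ≤ C * Λ ^ (N + K) * (κ⁻¹ ^ (N + K) / (4 * M) ^ K) * W := by
        gcongr
    _ = C / (4 * M) ^ K * Λ ^ (N + K) * κ⁻¹ ^ (N + K) * W := by ring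

set_option maxHeartbeats 400000 in
-- the glue of two long cores through the regime reduction; many binders
/-- **T2sA · `stub_coneKernelLargeStableLayerPoly`** — the BF-stable large-Λ cone kernel bound in the
threshold layer `|ω − mω₊| ≤ 2ξ₁κ` with Λ-polynomial constants (registered signature, skeleton v9.2).
Threshold core + sliver core, glued by the regime reduction with the landed census. -/
theorem stub_coneKernelLargeStableLayerPoly :
    (∀ M : ℝ, 0 < M → ∀ θ : ℝ, 0 < θ → ∀ θ₁ : ℝ, 0 < θ₁ →
      ∃ (ξ₁ Λ₀ a₁ ε₀ C : ℝ) (N : ℕ), 0 < ξ₁ ∧ a₁ < M ∧ 0 < ε₀ ∧ 0 < C ∧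
      ∀ a : ℝ, a₁ ≤ |a| → Kerr.IsSubextremal M a →
        ∀ (ω : ℝ) (m : ℤ) (Λ : ℝ), Kerr.IsAdmissibleTriple a ω m Λ → m ≠ 0 → Λ₀ < Λ →
          (1 + θ₁) * (2 * Kerr.rPlus M a * ω) ^ 2 ≤ Λ - 2 * a * m * ω →
          |ω - m * Kerr.horizonAngularVelocity M a| ≤ ε₀ * |(m : ℝ)| →
          |ω - m * Kerr.horizonAngularVelocity M a| ≤ 2 * ξ₁ * Kerr.surfaceGravity M a →
            ∀ RH RI : ℝ → ℂ,
              Kerr.IsRadialTeukolskySolution M a 0 ω m (Λ - a ^ 2 * ω ^ 2) RH →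
              Kerr.IsNormalisedHorizonSolution M a 0 ω m RH →
              Kerr.IsRadialTeukolskySolution M a 0 ω m (Λ - a ^ 2 * ω ^ 2) RI →
              Kerr.IsNormalisedInfinitySolution M 0 ω RI →
                ∀ r r' : ℝ, Kerr.rPlus M a < r → r ≤ r' →
                  Kerr.rPlus M a + θ * (Kerr.rPlus M a - Kerr.rMinus M a) ≤ r' →
                    Real.sqrt (r ^ 2 + a ^ 2) * ‖RH r‖ * (Real.sqrt (r' ^ 2 + a ^ 2) * ‖RI r'‖) ≤
                      C * Λ ^ N * (Kerr.surfaceGravity M a)⁻¹ ^ N * ‖Kerr.radialWronskian M a 0 RH RI r‖) := by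
  intro M hM θ hθ θ₁ hθ₁
  -- the two cores
  obtain ⟨ΛT, aT, εT, CT, NT, haT, hεT, hCT, hcoreT⟩ :=
    Kerr.thresholdRegime_corePoly stub_fullConeCensus hM hθ hθ₁
  obtain ⟨ξ₁, ΛS, aS, εS, CS, NS, hξ₁, haS, hεS, hCS, hcoreS⟩ :=
    Kerr.sliverRegime_corePoly stub_fullConeCensus hM hθ hθ₁
  -- unified constants
  set Λ₀ := max ΛT ΛS with hΛ₀
  set N := NT + NS with hN
  set C := CT / (4 * M) ^ NS + CS / (4 * M) ^ NT with hC
  have h4M : 0 < 4 * M := by positivity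
  have hC0 : 0 < C := by rw [hC]; positivity
  -- the regime
  set P : ℝ → ℝ → ℤ → ℝ → Prop := fun a ω m Λ ↦ Λ₀ < Λ ∧
    (1 + θ₁) * (2 * Kerr.rPlus M a * ω) ^ 2 ≤ Λ - 2 * a * m * ω ∧
    |ω - m * Kerr.horizonAngularVelocity M a| ≤ 2 * ξ₁ * Kerr.surfaceGravity M a with hPdef
  have hP : ∀ a ω m Λ, P a ω m Λ → P a (-ω) (-m) Λ := by
    intro a ω m Λ ⟨h1, h2, h3⟩
    refine ⟨h1, ?_, ?_⟩
    · have e1 : (2 * Kerr.rPlus M a * -ω) ^ 2 = (2 * Kerr.rPlus M a * ω) ^ 2 := by ring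
      have e2 : Λ - 2 * a * ((-m : ℤ) : ℝ) * -ω = Λ - 2 * a * m * ω := by push_cast; ring
      rw [e1, e2]; exact h2
    · have e : -ω - ((-m : ℤ) : ℝ) * Kerr.horizonAngularVelocity M a =
          -(ω - m * Kerr.horizonAngularVelocity M a) := by push_cast; ring
      rw [e, abs_neg]; exact h3
  -- the combined core for `0 < m`
  have hcore : ∀ a : ℝ, max aT aS ≤ |a| → Kerr.IsSubextremal M a →
      ∀ (ω : ℝ) (m : ℤ) (Λ : ℝ), Kerr.IsAdmissibleTriple a ω m Λ → 0 < m →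
        |ω - m * Kerr.horizonAngularVelocity M a| ≤ min εT εS * |(m : ℝ)| → P a ω m Λ →
          ∀ ρ : ℝ → ℝ, Kerr.IsTortoiseRadius M a ρ →
          ∀ uH uH₁ uI uI₁ : ℝ → ℂ,
            (∀ x, HasDerivAt uH (uH₁ x) x ∧
              HasDerivAt uH₁ (-(((ω ^ 2 - Kerr.sepPotential M a ω m Λ (ρ x) : ℝ) : ℂ) * uH x)) x) →
            (∀ x, HasDerivAt uI (uI₁ x) x ∧
              HasDerivAt uI₁ (-(((ω ^ 2 - Kerr.sepPotential M a ω m Λ (ρ x) : ℝ) : ℂ) * uI x)) x) →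
            Tendsto (fun x ↦ ‖uH x‖) atBot (𝓝 1) →
            Tendsto (fun x ↦ ‖uH₁ x‖) atBot (𝓝 |ω - m * Kerr.horizonAngularVelocity M a|) →
            (∀ x, (starRingEnd ℂ (uH x) * uH₁ x).im = -(ω - m * Kerr.horizonAngularVelocity M a)) →
            Tendsto (fun x ↦ ‖uI x‖) atTop (𝓝 1) →
            Tendsto (fun x ↦ ‖uI₁ x‖) atTop (𝓝 |ω|) →
            (∀ x, (starRingEnd ℂ (uI x) * uI₁ x).im = ω) →
              ∀ x x' : ℝ, x ≤ x' → Kerr.rPlus M a + θ * (Kerr.rPlus M a - Kerr.rMinus M a) ≤ ρ x' →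
                ‖uH x‖ * ‖uI x'‖ ≤
                  C * Λ ^ N * (Kerr.surfaceGravity M a)⁻¹ ^ N * ‖uH x * uI₁ x - uI x * uH₁ x‖ := by
    intro a ha hsub ω m Λ hadm hm hcone hPw ρ hρ uH uH₁ uI uI₁ hu hv hH0 hH1 hHf hI0 hI1 hIf x x' hxx' hx'
    obtain ⟨hΛ, hBF, hsl⟩ := hPw
    have hκ : 0 < Kerr.surfaceGravity M a := hsub.surfaceGravity_pos
    have hκle : Kerr.surfaceGravity M a ≤ 1 / (4 * M) := Kerr.surfaceGravity_le hM a
    have hm1 : (1 : ℝ) ≤ m := by exact_mod_cast hm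
    have hΛ1 : 1 ≤ Λ := by nlinarith only [hadm.sq_le, hm1]
    have hW0 : 0 ≤ ‖uH x * uI₁ x - uI x * uH₁ x‖ := norm_nonneg _
    have hΛT : ΛT < Λ := lt_of_le_of_lt (le_max_left _ _) hΛ
    have hΛS : ΛS < Λ := lt_of_le_of_lt (le_max_right _ _) hΛ
    rcases eq_or_ne (ω - m * Kerr.horizonAngularVelocity M a) 0 with hσ | hσ
    · -- threshold core
      have h := hcoreT a ((le_max_left _ _).trans ha) hsub ω m Λ hadm hm hΛT hBF
        (hcone.trans (mul_le_mul_of_nonneg_right (min_le_left _ _) (abs_nonneg _))) hσ ρ hρ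
        uH uH₁ uI uI₁ hu hv hH0 hH1 hHf hI0 hI1 hIf x x' hxx' hx'
      refine h.trans ((polyConst_raise NT NS hM hκ hκle hΛ1 hCT.le hW0).trans ?_)
      have hle : CT / (4 * M) ^ NS ≤ C := by
        have : 0 ≤ CS / (4 * M) ^ NT := by positivity
        rw [hC]; linarith only [this]
      rw [hN]; gcongr
    · -- sliver core
      have h := hcoreS a ((le_max_right _ _).trans ha) hsub ω m Λ hadm hm hΛS hBF
        (hcone.trans (mul_le_mul_of_nonneg_right (min_le_right _ _) (abs_nonneg _))) hσ hsl ρ hρ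
        uH uH₁ uI uI₁ hu hv hH0 hH1 hHf hI0 hI1 hIf x x' hxx' hx'
      refine h.trans ((polyConst_raise NS NT hM hκ hκle hΛ1 hCS.le hW0).trans ?_)
      have hle : CS / (4 * M) ^ NT ≤ C := by
        have : 0 ≤ CT / (4 * M) ^ NS := by positivity
        rw [hC]; linarith only [this]
      rw [hN, Nat.add_comm NT NS]; gcongr
  -- the regime reduction
  obtain ⟨a₂, ε₂, ha₂, hε₂, -, -, hred⟩ := Kerr.Costa2019.kernelBound_of_tortoise_core_regime hM
    (max_lt haT haS) (lt_min hεT hεS) P hP hcore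
  refine ⟨ξ₁, Λ₀, a₂, ε₂, C, N, hξ₁, ha₂, hε₂, hC0, ?_⟩
  intro a ha hsub ω m Λ hadm hm hΛ hBF hcone hsl RH RI hH hnH hI hnI r r' hr hrr' hr'
  exact hred a ha hsub ω m Λ hadm hm hcone ⟨hΛ, hBF, hsl⟩ RH RI hH hnH hI hnI r r' hr hrr' hr'

end Summit.FinalStateConjecture.FinalStateConjecture.Theorems.KappaExplicitWaveDecay.OlverDunsterUniformReduction

end
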